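import Mathlib.Analysis.SpecialFunctions.Trigonometric.Bounds
import Literature.MathematicalPhysics.QuantumLattice.SpinChains
import Literature.MathematicalPhysics.QuantumLattice.SpinChainsSpinSystemProofs
import Literature.MathematicalPhysics.QuantumLattice.HeisenbergModelProofs
import Literature.MathematicalPhysics.QuantumLattice.InfiniteVolumeLSMBondProofs
import Literature.MathematicalPhysics.QuantumLattice.FinDimSpectrumClusterGapProofs
import HarnessLib

/-!
# The Lieb–Schultz–Mattis / Affleck–Lieb theorem on the finite ring (`lsm_affleck_lieb`)

Sibling proof file (theorems only: no definitions, no new named facts) of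
`Literature/MathematicalPhysics/QuantumLattice/SpinChains.lean`, discharging the named fact
`Literature.MathematicalPhysics.QuantumLattice.lsm_affleck_lieb` (**hubbard.S14**; Lieb–Schultz–Mattis,
Ann. Phys. 16 (1961) 407, App. B, Thm 2; Affleck–Lieb, Lett. Math. Phys. 12 (1986) 57, Thm 1):
for the spin-`n/2` (`n` odd) antiferromagnetic Heisenberg ring `heisenbergRing L n` of even length
`L ≥ 2` with a unique ground state, `spectralGap ≤ C/L` with `C = π² n² = 4π² S²`.

We follow the original finite-volume variational proof of Lieb–Schultz–Mattis as extended to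
half-odd-integer spin by Affleck–Lieb (summarised in Tasaki (2022) §1, "Basic strategies", and
§3.1, Lemma 3.1), in the concrete `ℓ²((ℤ/L → Fin (n+1)))` picture of the tree:

1. **Variational principle for the gap** (`spectralGap_le_of_orthogonal`, min–max): for a Hermitian
   matrix with a unique ground state `ψ`, any `φ ⊥ ψ` with Rayleigh quotient `≤ e` forces
   `spectralGap ≤ e - E₀` (two eigenvalues, with multiplicity, lie below `e`, by the counting form
   of Courant–Fischer `finrank_le_card_eigenvalues_le`; only one of them is `E₀`).
2. **The twist** `U = exp[-i Σ_x θ_x (Ŝᶻ_x + S)]`, `θ_x = 2π val(x)/L` (`twistOp` of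
   `SpinFlipTwist.lean`), and the **bond identity summed over the ring**
   (`lsm_twist_conj_heisenbergRing`): `UᴴHU + UHUᴴ - 2H = (2cos(2π/L) - 2) Σ_i (SˣSˣ + SʸSʸ)_{i,i+1}`
   — the bond closing the ring is twisted by `2π(1-L)/L ≡ 2π/L`. With `S²·1 ± SᵅSᵅ' ≥ 0` and
   `2 - 2cos x ≤ x²` this gives the **energy estimate** (`lsm_twist_energy_le`)
   `⟨Uψ, HUψ⟩ + ⟨Uᴴψ, HUᴴψ⟩ ≤ 2E₀ + 2π²n²/L`.
3. **Orthogonality** `⟨ψ, Uψ⟩ = ⟨ψ, Uᴴψ⟩ = 0` (`lsm_twist_expect_eq_zero`): the unique ground state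
   is translation covariant (`groundState_shift_eq_smul`) and is an `SU(2)` singlet, in particular
   `Ŝᶻ_tot ψ = 0` (`groundState_mem_spinZSector_zero`, from `[Ŝˣ_tot, Ŝʸ_tot] = iŜᶻ_tot` acting on the
   ground line); translating the twist multiplies its diagonal entries by `e^{ia Σ_x(Ŝᶻ_x+S)}`
   (`twistOp_apply_shift`), which on the support of `ψ` is `e^{iπn} = -1` for odd `n`.
4. **Assembly** (`lsm_affleck_lieb_holds`): the better of the two trial states `Uψ`, `Uᴴψ` has energy
   `≤ E₀ + π²n²/L`.

(The hypothesis `Even L` of the fact is not used by the argument: for odd `L` and odd `n` an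
`SU(2)`-invariant Hamiltonian has no non-degenerate ground state, and indeed step 3 shows directly
that the hypotheses force `⟨ψ, Uψ⟩ = -⟨ψ, Uψ⟩`.)

## Sources

* I. Affleck, E. H. Lieb, *A proof of part of Haldane's conjecture on spin chains*, Lett. Math.
  Phys. **12** (1986) 57–69, Thm 1 (finite chain, half-odd-integer spin: gap `≤ const/L`).
  [AffleckLiebLMP1986] (paywalled, acquisition requested; statement and proof architecture taken
  from the secondary sources below.)
* E. Lieb, T. Schultz, D. Mattis, *Two soluble models of an antiferromagnetic chain*, Ann. Phys.
  **16** (1961) 407–466, App. B, Thm 2 (the twist operator and the variational estimate).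
* H. Tasaki, *The Lieb–Schultz–Mattis theorem: a topological point of view*, arXiv:2202.06243
  (held: `paper:arxiv-2202.06243`), §1 "Basic strategies" (p. 2 of the text: the finite-volume
  proof — uniqueness and rotation invariance, the trial state `Û_twist Φ_GS`, the estimate (1.3)
  `⟨Ψ|H|Ψ⟩ - E_GS ≤ const/L`, and the orthogonality `⟨Φ_GS|Ψ⟩ = 0`), §3.1 Lemma 3.1 and its proof
  (the bond identity `Ûᴴĥ_jÛ + Ûĥ_jÛᴴ - 2ĥ_j = 2J{cos(θ_j-θ_{j+1})-1}(ŜˣŜˣ+ŜʸŜʸ)`, `0 ≤ 1 - cos θ ≤ θ²/2`).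
* Tree ingredients: `conjTranspose_twistOp_conj_spinDot_add` (`InfiniteVolumeTwistProofs`),
  `posSemidef_sq_smul_one_add_siteSpin_mul'` (`XYOrderDischarges`),
  `LiebMattis.totalSpin_zero_commutator_one`, `LiebMattis.mem_spinZSector_iff` (`LiebMattisLadder`),
  `commute_heisenbergRing_totalSpin_holds` (`SpinChainsSpinSystemProofs`), `reindexOp_spinDot`
  (`HeisenbergModelProofs`), `finrank_le_card_eigenvalues_le` (`FinDimSpectrumClusterGapProofs`),
  `posSemidef_sub_groundEnergy`, `groundSpace_ne_bot_holds`, `mulVec_mem_groundSpace_of_commute`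
  (`FinDimSpectrumProofs`).
-/

noncomputable section

open Matrix Complex Finset Module
open scoped InnerProductSpace ComplexOrder

namespace Literature.MathematicalPhysics.QuantumLattice

namespace LiebSchultzMattis

section Spectral

variable {m : Type*} [Fintype m] [DecidableEq m]

omit [DecidableEq m] in
/-- `⟨v, v⟩ = ‖v‖²` for the dot product on `m → ℂ` (Euclidean norm of `toLp 2 v`). [folklore] -/
theorem star_dotProduct_self_eq_normSq_toLp (v : m → ℂ) :
    star v ⬝ᵥ v = ((‖(WithLp.toLp 2 v : EuclideanSpace ℂ m)‖ ^ 2 : ℝ) : ℂ) := by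
  rw [dotProduct_comm, ← EuclideanSpace.inner_toLp_toLp, inner_self_eq_norm_sq_to_K]
  norm_cast

omit [DecidableEq m] in
/-- `re ⟨v, v⟩ = ‖v‖²`. [folklore] -/
theorem re_star_dotProduct_self (v : m → ℂ) :
    (star v ⬝ᵥ v).re = ‖(WithLp.toLp 2 v : EuclideanSpace ℂ m)‖ ^ 2 := by
  rw [star_dotProduct_self_eq_normSq_toLp, Complex.ofReal_re]

omit [Fintype m] [DecidableEq m] in
/-- `toLp 2 v = 0 ↔ v = 0`. [folklore] -/
theorem toLp_two_eq_zero_iff (v : m → ℂ) : (WithLp.toLp 2 v : EuclideanSpace ℂ m) = 0 ↔ v = 0 :=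
  ⟨fun h => by simpa using congrArg WithLp.ofLp h, fun h => by rw [h]; rfl⟩

/-- **Variational upper bound on the spectral gap (min–max).** Let `A` be Hermitian with a unique
ground state, `ψ ≠ 0` a ground-state vector (`A ψ = E₀ ψ`) and `φ ≠ 0` orthogonal to `ψ` with
Rayleigh quotient at most `e` (`re ⟨φ, A φ⟩ ≤ e ⟨φ, φ⟩`). Then the spectral gap of `A` is at most
`e - E₀`: the quadratic form of `A` is `≤ e` on the two-dimensional space spanned by `ψ, φ`, so
at least two eigenvalues (with multiplicity) are `≤ e` (`finrank_le_card_eigenvalues_le`), and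
only one of them equals `E₀`. Reed–Simon IV, Thm XIII.1–XIII.2; Tasaki (2020) §2.1. [folklore] -/
theorem spectralGap_le_of_orthogonal {A : Matrix m m ℂ} (hA : A.IsHermitian)
    (hU : A.HasUniqueGroundState) {ψ φ : m → ℂ} (hψ : A *ᵥ ψ = (A.groundEnergy : ℂ) • ψ)
    (hψ0 : ψ ≠ 0) (hφ0 : φ ≠ 0) (horth : star ψ ⬝ᵥ φ = 0) {e : ℝ}
    (he : (star φ ⬝ᵥ A *ᵥ φ).re ≤ e * (star φ ⬝ᵥ φ).re) :
    A.spectralGap ≤ e - A.groundEnergy := by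
  classical
  set E₀ : ℝ := A.groundEnergy with hE₀def
  -- Euclidean copies
  set ψ' : EuclideanSpace ℂ m := WithLp.toLp 2 ψ with hψ'
  set φ' : EuclideanSpace ℂ m := WithLp.toLp 2 φ with hφ'
  have hψ'0 : ψ' ≠ 0 := fun h => hψ0 ((toLp_two_eq_zero_iff ψ).1 h)
  have hφ'0 : φ' ≠ 0 := fun h => hφ0 ((toLp_two_eq_zero_iff φ).1 h)
  have hinner : ∀ v w : m → ℂ,
      ⟪(WithLp.toLp 2 v : EuclideanSpace ℂ m), WithLp.toLp 2 w⟫_ℂ = star v ⬝ᵥ w := fun v w => by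
    rw [EuclideanSpace.inner_toLp_toLp, dotProduct_comm]
  have horth' : ⟪ψ', φ'⟫_ℂ = 0 := by rw [hψ', hφ', hinner, horth]
  have horth'' : ⟪φ', ψ'⟫_ℂ = 0 := by rw [← inner_conj_symm, horth', map_zero]
  -- the operator and its action on `ψ'`
  set T := toEuclideanLin A with hT
  have hTψ : T ψ' = (E₀ : ℂ) • ψ' := by
    rw [hT, hψ']
    change WithLp.toLp 2 (A *ᵥ ψ) = _
    rw [hψ, WithLp.toLp_smul]
  have hsym : (T : EuclideanSpace ℂ m →ₗ[ℂ] EuclideanSpace ℂ m).IsSymmetric :=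
    isSymmetric_toEuclideanLin_iff.mpr hA
  have hψTφ : ⟪ψ', T φ'⟫_ℂ = 0 := by
    rw [← hsym ψ' φ', hTψ, inner_smul_left, horth', mul_zero]
  have hφTψ : ⟪φ', T ψ'⟫_ℂ = 0 := by
    rw [hTψ, inner_smul_right, horth'', mul_zero]
  -- `E₀ ≤ e`
  have hφφ : 0 < (star φ ⬝ᵥ φ).re := by
    rw [re_star_dotProduct_self]
    exact pow_pos (norm_pos_iff.mpr hφ'0) 2
  have hE₀φ : E₀ * (star φ ⬝ᵥ φ).re ≤ (star φ ⬝ᵥ A *ᵥ φ).re := by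
    have h := (posSemidef_sub_groundEnergy hA).dotProduct_mulVec_nonneg φ
    rw [sub_mulVec, dotProduct_sub, Algebra.algebraMap_eq_smul_one, smul_mulVec, one_mulVec,
      dotProduct_smul] at h
    obtain ⟨hre, -⟩ := Complex.nonneg_iff.mp h
    rw [Complex.sub_re, Complex.smul_re, smul_eq_mul] at hre
    linarith
  have hE₀e : E₀ ≤ e := le_of_mul_le_mul_right (hE₀φ.trans he) hφφ
  -- the Rayleigh quotient of `φ'`
  have hφform : RCLike.re ⟪φ', T φ'⟫_ℂ ≤ e * ‖φ'‖ ^ 2 := by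
    have h1 : ⟪φ', T φ'⟫_ℂ = star φ ⬝ᵥ A *ᵥ φ := by
      rw [hT, hφ']
      change ⟪(WithLp.toLp 2 φ : EuclideanSpace ℂ m), WithLp.toLp 2 (A *ᵥ φ)⟫_ℂ = _
      rw [hinner]
    rw [h1, ← re_star_dotProduct_self]
    exact he
  have hψform : RCLike.re ⟪ψ', T ψ'⟫_ℂ = E₀ * ‖ψ'‖ ^ 2 := by
    rw [hTψ, inner_smul_right, inner_self_eq_norm_sq_to_K]
    change (((E₀ : ℂ)) * ((‖ψ'‖ : ℂ) ^ 2)).re = _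
    norm_cast
  -- the two-dimensional trial space
  set K : Submodule ℂ (EuclideanSpace ℂ m) := Submodule.span ℂ (Set.range ![ψ', φ']) with hK
  have hli : LinearIndependent ℂ ![ψ', φ'] := by
    refine linearIndependent_of_ne_zero_of_inner_eq_zero ?_ ?_
    · intro i
      fin_cases i
      · exact hψ'0
      · exact hφ'0
    · intro i j hij
      fin_cases i <;> fin_cases j
      · exact absurd rfl hij
      · exact horth'
      · exact horth''
      · exact absurd rfl hij
  have hK2 : finrank ℂ K = 2 := by
    rw [hK, finrank_span_eq_card hli, Fintype.card_fin]
  have hKform : ∀ x ∈ K, RCLike.re ⟪x, T x⟫_ℂ ≤ e * ‖x‖ ^ 2 := by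
    intro x hx
    rw [hK, Submodule.mem_span_range_iff_exists_fun] at hx
    obtain ⟨c, rfl⟩ := hx
    simp only [Fin.sum_univ_two, Matrix.cons_val_zero, Matrix.cons_val_one]
    set a := c 0
    set b := c 1
    -- expand the form: cross terms vanish
    have hcross : ⟪a • ψ', b • φ'⟫_ℂ = 0 := by
      rw [inner_smul_left, inner_smul_right, horth', mul_zero, mul_zero]
    have hnorm : ‖a • ψ' + b • φ'‖ ^ 2 = ‖a‖ ^ 2 * ‖ψ'‖ ^ 2 + ‖b‖ ^ 2 * ‖φ'‖ ^ 2 := by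
      rw [pow_two, norm_add_sq_eq_norm_sq_add_norm_sq_of_inner_eq_zero _ _ hcross, norm_smul,
        norm_smul]
      ring
    have hexp : ⟪a • ψ' + b • φ', T (a • ψ' + b • φ')⟫_ℂ =
        (starRingEnd ℂ a * a) * ⟪ψ', T ψ'⟫_ℂ + (starRingEnd ℂ b * b) * ⟪φ', T φ'⟫_ℂ := by
      rw [map_add, map_smul, map_smul, inner_add_left, inner_add_right, inner_add_right,
        inner_smul_left, inner_smul_left, inner_smul_left, inner_smul_left, inner_smul_right,
        inner_smul_right, inner_smul_right, inner_smul_right, hψTφ, hφTψ]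
      ring
    have hre : RCLike.re ⟪a • ψ' + b • φ', T (a • ψ' + b • φ')⟫_ℂ =
        ‖a‖ ^ 2 * RCLike.re ⟪ψ', T ψ'⟫_ℂ + ‖b‖ ^ 2 * RCLike.re ⟪φ', T φ'⟫_ℂ := by
      rw [hexp, map_add]
      have ha : starRingEnd ℂ a * a = ((‖a‖ ^ 2 : ℝ) : ℂ) := by
        rw [RCLike.conj_mul]; norm_cast
      have hb : starRingEnd ℂ b * b = ((‖b‖ ^ 2 : ℝ) : ℂ) := by
        rw [RCLike.conj_mul]; norm_cast
      rw [ha, hb]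
      simp only [RCLike.re_to_complex, Complex.re_ofReal_mul]
    rw [hre, hnorm, hψform, mul_add]
    have h1 : ‖a‖ ^ 2 * (E₀ * ‖ψ'‖ ^ 2) ≤ e * (‖a‖ ^ 2 * ‖ψ'‖ ^ 2) := by
      have := mul_le_mul_of_nonneg_left hE₀e (mul_nonneg (sq_nonneg ‖a‖) (sq_nonneg ‖ψ'‖))
      nlinarith
    have h2 : ‖b‖ ^ 2 * RCLike.re ⟪φ', T φ'⟫_ℂ ≤ e * (‖b‖ ^ 2 * ‖φ'‖ ^ 2) := by
      have := mul_le_mul_of_nonneg_left hφform (sq_nonneg ‖b‖)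
      nlinarith
    exact add_le_add h1 h2
  -- counting: at least two eigenvalues `≤ e`, exactly one equal to `E₀`
  have hcount := finrank_le_card_eigenvalues_le hA K hKform
  rw [hK2] at hcount
  have hone : #{i | hA.eigenvalues i = E₀} = 1 := by
    rw [hA.card_filter_eigenvalues_eq]
    exact hU
  obtain ⟨i, hile, hine⟩ : ∃ i, hA.eigenvalues i ≤ e ∧ hA.eigenvalues i ≠ E₀ := by
    by_contra hcon
    push Not at hcon
    have hsub : (univ.filter fun i => hA.eigenvalues i ≤ e) ⊆
        univ.filter fun i => hA.eigenvalues i = E₀ := by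
      intro i hi
      rw [mem_filter] at hi ⊢
      exact ⟨hi.1, hcon i hi.2⟩
    have := card_le_card hsub
    omega
  -- unfold the spectral gap
  have hspec : A.spectralGap = sInf (Set.range hA.eigenvalues \ {E₀}) - E₀ := by
    rw [Matrix.spectralGap, ContinuousLinearMap.spectralGap, hA.re_image_spectrum_toEuclideanCLM]
    rfl
  rw [hspec, sub_le_sub_iff_right]
  have hbdd : BddBelow (Set.range hA.eigenvalues \ {E₀}) :=
    ((Set.finite_range _).subset fun x hx => hx.1).bddBelow
  have hmem : hA.eigenvalues i ∈ Set.range hA.eigenvalues \ {E₀} :=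
    ⟨Set.mem_range_self i, fun h => hine (Set.mem_singleton_iff.mp h)⟩
  exact (csInf_le hbdd hmem).trans hile

end Spectral

section Ring

variable {L : ℕ} [NeZero L]

omit [NeZero L] in
/-- On a ring with at least two sites, `i ≠ i + 1` in `ℤ/Lℤ`. [folklore] -/
theorem ZMod.self_ne_add_one (hL : 2 ≤ L) (i : ZMod L) : i ≠ i + 1 := by
  haveI : Fact (1 < L) := ⟨hL⟩
  intro h
  have h1 : (1 : ZMod L) = 0 := by
    have := congrArg (fun z => z - i) h
    simpa using this.symm
  exact one_ne_zero h1

/-- The representative of `x + 1` in `{0, …, L-1}`: `val (x + 1) = val x + 1 - L q` with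
`q = ⌊(val x + 1)/L⌋ ∈ {0, 1}` (as real numbers). [folklore] -/
theorem ZMod.val_add_one_real (hL : 2 ≤ L) (x : ZMod L) :
    (((x + 1).val : ℕ) : ℝ) = (x.val : ℝ) + 1 - (L : ℝ) * (((x.val + 1) / L : ℕ) : ℝ) := by
  haveI : Fact (1 < L) := ⟨hL⟩
  have h1 : (x + 1).val = (x.val + 1) % L := by rw [ZMod.val_add, ZMod.val_one]
  have h2 := Nat.div_add_mod (x.val + 1) L
  rw [h1]
  have h3 : (((x.val + 1) % L : ℕ) : ℝ) = ((x.val + 1 : ℕ) : ℝ) - (L : ℝ) * (((x.val + 1) / L : ℕ) : ℝ) := by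
    rw [eq_sub_iff_add_eq, add_comm]
    exact_mod_cast h2
  rw [h3]
  push_cast
  ring

/-- The twist angles `θ_x = 2π val(x)/L` of the Lieb–Schultz–Mattis twist differ by `-2π/L` modulo
`2π` across every bond `(x, x+1)` of the ring, including the bond `(L-1, 0)`; hence
`cos(θ_x - θ_{x+1}) = cos(2π/L)`. Lieb–Schultz–Mattis (1961) App. B; Tasaki (2022) §1. [folklore] -/
theorem cos_lsmAngle_sub (hL : 2 ≤ L) (x : ZMod L) :
    Real.cos (2 * Real.pi * (x.val : ℝ) / L - 2 * Real.pi * ((x + 1).val : ℝ) / L) =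
      Real.cos (2 * Real.pi / L) := by
  have hL0 : (L : ℝ) ≠ 0 := by exact_mod_cast (show L ≠ 0 by omega)
  rw [ZMod.val_add_one_real hL x]
  have : 2 * Real.pi * (x.val : ℝ) / L -
      2 * Real.pi * ((x.val : ℝ) + 1 - (L : ℝ) * (((x.val + 1) / L : ℕ) : ℝ)) / L =
      -(2 * Real.pi / L) + (((x.val + 1) / L : ℕ) : ℝ) * (2 * Real.pi) := by
    field_simp
    ring
  rw [this, Real.cos_add_nat_mul_two_pi, Real.cos_neg]

variable (n : ℕ)

/-- **The twisted ring Hamiltonian (Lieb–Schultz–Mattis bond identity, summed over the ring).**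
For the twist `U = exp[-i Σ_x θ_x (Ŝᶻ_x + S)]`, `θ_x = 2π val(x)/L`, of the periodic chain,
`Uᴴ H U + U H Uᴴ - 2H = (2cos(2π/L) - 2) Σ_i (Sˣ_iSˣ_{i+1} + Sʸ_iSʸ_{i+1})`: every bond, including the
one closing the ring, is twisted by the same angle `2π/L` (`conjTranspose_twistOp_conj_spinDot_add`,
`cos_lsmAngle_sub`). Lieb–Schultz–Mattis, Ann. Phys. 16 (1961) 407, App. B; Affleck–Lieb (1986)
Thm 1 (proof); Tasaki (2022) §3.1, proof of Lemma 3.1. [cite: AffleckLiebLMP1986, Thm. 1] -/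
theorem lsm_twist_conj_heisenbergRing (hL : 2 ≤ L) :
    (twistOp fun x : ZMod L => 2 * Real.pi * (x.val : ℝ) / L)ᴴ * heisenbergRing L n *
          twistOp (fun x : ZMod L => 2 * Real.pi * (x.val : ℝ) / L) +
        twistOp (fun x : ZMod L => 2 * Real.pi * (x.val : ℝ) / L) * heisenbergRing L n *
          (twistOp fun x : ZMod L => 2 * Real.pi * (x.val : ℝ) / L)ᴴ -
        (2 : ℂ) • heisenbergRing L n =
      ((2 * Real.cos (2 * Real.pi / L) - 2 : ℝ) : ℂ) •
        ∑ i : ZMod L, (spinBond n 0 i (i + 1) + spinBond n 1 i (i + 1)) := by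
  set U : Op (ZMod L) (n + 1) := twistOp fun x : ZMod L => 2 * Real.pi * (x.val : ℝ) / L with hU
  have hH : heisenbergRing L n = ∑ i : ZMod L, spinDot n i (i + 1) := rfl
  rw [hH, Finset.mul_sum, Finset.sum_mul, Finset.mul_sum, Finset.sum_mul, Finset.smul_sum,
    ← Finset.sum_add_distrib, ← Finset.sum_sub_distrib, Finset.smul_sum]
  refine Finset.sum_congr rfl fun i _ => ?_
  have h := conjTranspose_twistOp_conj_spinDot_add n
    (fun x : ZMod L => 2 * Real.pi * (x.val : ℝ) / L) (ZMod.self_ne_add_one hL i)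
  rw [two_smul] at h
  rw [two_smul, ← hU] at *
  rw [h, cos_lsmAngle_sub hL i]

/-- **A priori bound on a bond expectation**: `re ⟨ψ, ½(Sᵅ_xSᵅ_y + Sᵅ_ySᵅ_x) ψ⟩ ≥ -S² ⟨ψ, ψ⟩`
(`S = n/2`), from the Loewner bound `S²·1 + Sᵅ_xSᵅ_y ≥ 0` (`posSemidef_sq_smul_one_add_siteSpin_mul'`).
Tasaki (2022) §3.1, eq. (3.12) (`‖Ûᴴĥ_jÛ + Ûĥ_jÛᴴ - 2ĥ_j‖ ≤ 2J(θ_j-θ_{j+1})²S²`). [folklore] -/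
theorem neg_sq_mul_le_re_expect_spinBond {Λ : Type*} [Fintype Λ] [DecidableEq Λ] (α : Fin 3)
    (x y : Λ) (ψ : TensorIndex Λ (n + 1) → ℂ) :
    -(((n : ℝ) / 2) ^ 2 * (star ψ ⬝ᵥ ψ).re) ≤ (star ψ ⬝ᵥ spinBond n α x y *ᵥ ψ).re := by
  have key : ∀ x y : Λ, -(((n : ℝ) / 2) ^ 2 * (star ψ ⬝ᵥ ψ).re) ≤
      (star ψ ⬝ᵥ (siteSpin n x α * siteSpin n y α) *ᵥ ψ).re := by
    intro x y
    have h := (posSemidef_sq_smul_one_add_siteSpin_mul' n x y α).dotProduct_mulVec_nonneg ψ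
    rw [add_mulVec, dotProduct_add, smul_mulVec, one_mulVec, dotProduct_smul, smul_eq_mul] at h
    obtain ⟨hre, -⟩ := Complex.nonneg_iff.mp h
    have hc : ((((n : ℂ) / 2) ^ 2) * (star ψ ⬝ᵥ ψ)).re = ((n : ℝ) / 2) ^ 2 * (star ψ ⬝ᵥ ψ).re := by
      have : ((n : ℂ) / 2) ^ 2 = ((((n : ℝ) / 2) ^ 2 : ℝ) : ℂ) := by push_cast; ring
      rw [this, Complex.re_ofReal_mul]
    rw [Complex.add_re, hc] at hre
    linarith
  have h1 := key x y
  have h2 := key y x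
  rw [spinBond, smul_mulVec, dotProduct_smul, add_mulVec, dotProduct_add, smul_eq_mul,
    Complex.mul_re]
  simp only [Complex.add_re, Complex.add_im]
  norm_num
  linarith

/-- **The Lieb–Schultz–Mattis variational estimate on the ring.** For a normalised eigenvector `ψ`
of the Heisenberg ring with eigenvalue `E` and the twist `U` (`θ_x = 2π val(x)/L`), the two trial
states `Uψ`, `Uᴴψ` satisfy `⟨Uψ, H Uψ⟩ + ⟨Uᴴψ, H Uᴴψ⟩ ≤ 2E + 2π²n²/L`
(`= 2E + 8π²S²/L`, `S = n/2`): the bond identity gives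
`⟨ψ,(UᴴHU + UHUᴴ - 2H)ψ⟩ = (2cos(2π/L) - 2) Σ_i ⟨SˣSˣ' + SʸSʸ'⟩`, each bond expectation is
`≥ -2S²`, and `2 - 2cos(2π/L) ≤ (2π/L)²`. Lieb–Schultz–Mattis (1961) App. B; Affleck–Lieb (1986)
Thm 1 (proof); Tasaki (2022) §1, eq. (1.3) and §3.1, Lemma 3.1. [cite: AffleckLiebLMP1986, Thm. 1] -/
theorem lsm_twist_energy_le (hL : 2 ≤ L) {ψ : TensorIndex (ZMod L) (n + 1) → ℂ} {E : ℝ}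
    (hψ : heisenbergRing L n *ᵥ ψ = (E : ℂ) • ψ) (hψ1 : star ψ ⬝ᵥ ψ = 1) :
    (star ψ ⬝ᵥ ((twistOp fun x : ZMod L => 2 * Real.pi * (x.val : ℝ) / L)ᴴ * heisenbergRing L n *
          twistOp (fun x : ZMod L => 2 * Real.pi * (x.val : ℝ) / L)) *ᵥ ψ).re +
      (star ψ ⬝ᵥ (twistOp (fun x : ZMod L => 2 * Real.pi * (x.val : ℝ) / L) * heisenbergRing L n *
          (twistOp fun x : ZMod L => 2 * Real.pi * (x.val : ℝ) / L)ᴴ) *ᵥ ψ).re ≤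
      2 * E + 2 * Real.pi ^ 2 * (n : ℝ) ^ 2 / L := by
  have hL0 : (0 : ℝ) < L := by exact_mod_cast (show 0 < L by omega)
  have hid := lsm_twist_conj_heisenbergRing n hL
  set U : Op (ZMod L) (n + 1) := twistOp fun x : ZMod L => 2 * Real.pi * (x.val : ℝ) / L with hU
  set H := heisenbergRing L n with hH
  set B : Op (ZMod L) (n + 1) := ∑ i : ZMod L, (spinBond n 0 i (i + 1) + spinBond n 1 i (i + 1))
    with hB
  set c : ℝ := 2 * Real.cos (2 * Real.pi / L) - 2 with hc
  -- apply `⟨ψ, · ψ⟩` to the bond identity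
  have h1 := congrArg (fun M : Op (ZMod L) (n + 1) => (star ψ ⬝ᵥ M *ᵥ ψ).re) hid
  rw [sub_mulVec, add_mulVec, dotProduct_sub, dotProduct_add, smul_mulVec, dotProduct_smul, hψ,
    dotProduct_smul, hψ1, smul_mulVec, dotProduct_smul, Complex.sub_re, Complex.add_re] at h1
  have h2 : ((2 : ℂ) • ((E : ℂ) • (1 : ℂ))).re = 2 * E := by
    simp [smul_eq_mul]
  have h3 : ((c : ℂ) • (star ψ ⬝ᵥ B *ᵥ ψ)).re = c * (star ψ ⬝ᵥ B *ᵥ ψ).re := by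
    rw [smul_eq_mul, Complex.re_ofReal_mul]
  rw [h2, h3] at h1
  -- lower bound on the bond sum
  have hBge : -(2 * (L : ℝ) * ((n : ℝ) / 2) ^ 2) ≤ (star ψ ⬝ᵥ B *ᵥ ψ).re := by
    have hsum : (star ψ ⬝ᵥ B *ᵥ ψ).re =
        ∑ i : ZMod L, ((star ψ ⬝ᵥ spinBond n 0 i (i + 1) *ᵥ ψ).re +
          (star ψ ⬝ᵥ spinBond n 1 i (i + 1) *ᵥ ψ).re) := by
      rw [hB, Matrix.sum_mulVec, dotProduct_sum, Complex.re_sum]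
      refine Finset.sum_congr rfl fun i _ => ?_
      rw [add_mulVec, dotProduct_add, Complex.add_re]
    rw [hsum]
    have hterm : ∀ i : ZMod L, -(2 * ((n : ℝ) / 2) ^ 2) ≤
        (star ψ ⬝ᵥ spinBond n 0 i (i + 1) *ᵥ ψ).re + (star ψ ⬝ᵥ spinBond n 1 i (i + 1) *ᵥ ψ).re := by
      intro i
      have h0 := neg_sq_mul_le_re_expect_spinBond n 0 i (i + 1) ψ
      have h1' := neg_sq_mul_le_re_expect_spinBond n 1 i (i + 1) ψ
      rw [hψ1, Complex.one_re, mul_one] at h0 h1'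
      linarith
    calc -(2 * (L : ℝ) * ((n : ℝ) / 2) ^ 2) = ∑ _i : ZMod L, -(2 * ((n : ℝ) / 2) ^ 2) := by
          rw [Finset.sum_const, Finset.card_univ, ZMod.card, nsmul_eq_mul]; ring
      _ ≤ _ := Finset.sum_le_sum fun i _ => hterm i
  -- `c ≤ 0` and `-c ≤ (2π/L)²`
  have hc0 : c ≤ 0 := by
    have := Real.cos_le_one (2 * Real.pi / L)
    rw [hc]; linarith
  have hc1 : -c ≤ (2 * Real.pi / L) ^ 2 := by
    have := Real.one_sub_sq_div_two_le_cos (x := 2 * Real.pi / L)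
    rw [hc]; linarith
  have hcX : c * (star ψ ⬝ᵥ B *ᵥ ψ).re ≤ (2 * Real.pi / L) ^ 2 * (2 * (L : ℝ) * ((n : ℝ) / 2) ^ 2) := by
    have hX := hBge
    have : c * (star ψ ⬝ᵥ B *ᵥ ψ).re ≤ (-c) * (2 * (L : ℝ) * ((n : ℝ) / 2) ^ 2) := by nlinarith
    refine this.trans ?_
    exact mul_le_mul_of_nonneg_right hc1 (by positivity)
  have hfinal : (2 * Real.pi / L) ^ 2 * (2 * (L : ℝ) * ((n : ℝ) / 2) ^ 2) =
      2 * Real.pi ^ 2 * (n : ℝ) ^ 2 / L := by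
    field_simp
  rw [hfinal] at hcX
  linarith

end Ring

section Ortho

variable {L : ℕ} [NeZero L] (n : ℕ)

/-- **Translation invariance of the ring (entrywise).** The matrix elements of the Heisenberg ring
are invariant under the simultaneous shift `σ ↦ σ(· + 1)` of both configurations
(`reindexOp (· + 1) H = H`, by `reindexOp_spinDot` and reindexing the bond sum).
Lieb–Schultz–Mattis (1961) App. B; Tasaki (2022) §1. [folklore] -/
theorem heisenbergRing_apply_shift (σ τ : TensorIndex (ZMod L) (n + 1)) :
    heisenbergRing L n (fun x => σ (x + 1)) (fun x => τ (x + 1)) = heisenbergRing L n σ τ := by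
  have hinv : reindexOp (Equiv.addRight (1 : ZMod L)) (heisenbergRing L n) = heisenbergRing L n := by
    rw [show heisenbergRing L n = ∑ i : ZMod L, spinDot n i (i + 1) from rfl, map_sum]
    simp only [reindexOp_spinDot, Equiv.coe_addRight]
    exact Equiv.sum_comp (Equiv.addRight (1 : ZMod L)) (fun i => spinDot n i (i + 1))
  have h := congrFun (congrFun hinv σ) τ
  rw [reindexOp_apply] at h
  simpa using h

/-- **A unique ground state of the ring is translation covariant**: `ψ(σ(·+1)) = μ ψ(σ)` with
`|μ| = 1`. The shifted vector is again a ground-state vector (translation invariance of `H`), the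
ground space is the line `ℂψ`, and the shift preserves the norm. Lieb–Schultz–Mattis (1961)
App. B; Tasaki (2022) §1. [folklore] -/
theorem groundState_shift_eq_smul (hU : (heisenbergRing L n).HasUniqueGroundState)
    {ψ : TensorIndex (ZMod L) (n + 1) → ℂ} (hψ : ψ ∈ (heisenbergRing L n).groundSpace)
    (hψ0 : ψ ≠ 0) :
    ∃ μ : ℂ, star μ * μ = 1 ∧ (fun σ => ψ (fun x => σ (x + 1))) = μ • ψ := by
  set H := heisenbergRing L n with hH
  -- the configuration shift as a bijection
  let g : TensorIndex (ZMod L) (n + 1) ≃ TensorIndex (ZMod L) (n + 1) :=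
    { toFun := fun σ x => σ (x + 1)
      invFun := fun σ x => σ (x - 1)
      left_inv := fun σ => funext fun x => by simp [sub_add_cancel]
      right_inv := fun σ => funext fun x => by simp [add_sub_cancel_right] }
  have hg : ∀ σ, g σ = fun x => σ (x + 1) := fun σ => rfl
  have hsub : H.submatrix g g = H := by
    ext σ τ
    rw [submatrix_apply, hg, hg]
    exact heisenbergRing_apply_shift n σ τ
  have hHψ := (mem_groundSpace_iff H ψ).1 hψ
  have hmem : (ψ ∘ g) ∈ H.groundSpace := by
    rw [mem_groundSpace_iff]
    calc H *ᵥ (ψ ∘ g) = (H.submatrix g g) *ᵥ (ψ ∘ g) := by rw [hsub]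
      _ = (H *ᵥ ((ψ ∘ g) ∘ g.symm)) ∘ g := submatrix_mulVec_equiv _ _ _ _
      _ = (H *ᵥ ψ) ∘ g := by rw [Function.comp_assoc, Equiv.self_comp_symm, Function.comp_id]
      _ = ((H.groundEnergy : ℂ) • ψ) ∘ g := by rw [hHψ]
      _ = (H.groundEnergy : ℂ) • (ψ ∘ g) := rfl
  have hspan : H.groundSpace = ℂ ∙ ψ :=
    eq_span_singleton_of_mem_of_finrank_eq_one hU hψ hψ0
  rw [hspan, Submodule.mem_span_singleton] at hmem
  obtain ⟨μ, hμ⟩ := hmem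
  refine ⟨μ, ?_, ?_⟩
  · -- norm preservation
    have hS : star ψ ⬝ᵥ ψ ≠ 0 := fun h => hψ0 (dotProduct_star_self_eq_zero.mp h)
    have h1 : star (ψ ∘ g) ⬝ᵥ (ψ ∘ g) = star ψ ⬝ᵥ ψ := by
      simp only [dotProduct, Pi.star_apply, Function.comp_apply]
      exact Equiv.sum_comp g (fun σ => star (ψ σ) * ψ σ)
    rw [← hμ, star_smul, smul_dotProduct, dotProduct_smul, smul_smul, smul_eq_mul] at h1
    exact mul_right_cancel₀ hS (h1.trans (one_mul _).symm)
  · show ψ ∘ g = μ • ψ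
    exact hμ.symm

/-- **A unique ground state of the ring has `Ŝᶻ_tot ψ = 0`** (it is an `SU(2)` singlet): each
`Ŝᵅ_tot` commutes with `H` (`commute_heisenbergRing_totalSpin`), hence acts on the ground line
`ℂψ` by a scalar `c_α`, and `iŜᶻ_tot ψ = [Ŝˣ_tot, Ŝʸ_tot]ψ = (c_x c_y - c_y c_x)ψ = 0`. So `ψ` lies in
the magnetisation sector `M = 0`. Lieb–Schultz–Mattis (1961) App. B (via Lieb–Mattis); Tasaki
(2022) §1 ("the uniqueness, along with the rotation invariance of the Hamiltonian, readily implies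
`exp[-iθΣⱼŜᶻⱼ]Φ_GS = Φ_GS`"). [folklore] -/
theorem groundState_mem_spinZSector_zero (hU : (heisenbergRing L n).HasUniqueGroundState)
    {ψ : TensorIndex (ZMod L) (n + 1) → ℂ} (hψ : ψ ∈ (heisenbergRing L n).groundSpace) :
    ψ ∈ spinZSector (Λ := ZMod L) n 0 := by
  set H := heisenbergRing L n with hH
  by_cases hψ0 : ψ = 0
  · rw [hψ0]; exact Submodule.zero_mem _
  have hspan : H.groundSpace = ℂ ∙ ψ :=
    eq_span_singleton_of_mem_of_finrank_eq_one hU hψ hψ0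
  have hscalar : ∀ α : Fin 3, ∃ c : ℂ, c • ψ = totalSpin n α *ᵥ ψ := by
    intro α
    have hcomm : totalSpin n α * H = H * totalSpin n α :=
      (commute_heisenbergRing_totalSpin_holds L n α).eq.symm
    have hmem := mulVec_mem_groundSpace_of_commute hcomm hψ
    rw [hspan, Submodule.mem_span_singleton] at hmem
    exact hmem
  obtain ⟨c₀, hc₀⟩ := hscalar 0
  obtain ⟨c₁, hc₁⟩ := hscalar 1
  have hcomm01 := congrArg (fun M : Op (ZMod L) (n + 1) => M *ᵥ ψ)
    (LiebMattis.totalSpin_zero_commutator_one (Λ := ZMod L) n)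
  rw [sub_mulVec, ← mulVec_mulVec, ← mulVec_mulVec, ← hc₀, ← hc₁, mulVec_smul, mulVec_smul,
    ← hc₀, ← hc₁, smul_smul, smul_smul, mul_comm c₀ c₁, sub_self, smul_mulVec] at hcomm01
  have hz : totalSpin n 2 *ᵥ ψ = 0 := by
    have := hcomm01.symm
    rw [smul_eq_zero] at this
    exact this.resolve_left I_ne_zero
  rw [spinZSector, Module.End.mem_eigenspace_iff, Matrix.toLin'_apply, hz, Complex.ofReal_zero,
    zero_smul]

/-- **The twist phase under translation.** For angles `θ_x = a·val(x)` with `aL ∈ 2πℤ` (so that the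
twist is single valued on the ring), shifting the configuration changes the phase
`φ_θ(σ) = Σ_x θ_x (Ŝᶻ_x + S)(σ)` by `-a N(σ)` modulo `2π`, where `N(σ) = Σ_x (Ŝᶻ_x + S)(σ)`:
this is `T̂ᴴ Û T̂ = exp[i a Σ_x(Ŝᶻ_x + S)] Û` (Lieb–Schultz–Mattis (1961) App. B; Tasaki (2018)
Lemma 2; Tasaki (2022) §3.2, proof of Lemma 3.3). [folklore] -/
theorem twistPhase_shift (hL : 2 ≤ L) {θ : ZMod L → ℝ} {a : ℝ} {k : ℤ}
    (hθ : ∀ x, θ x = a * (x.val : ℝ)) (ha : a * L = 2 * Real.pi * k)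
    (σ : TensorIndex (ZMod L) (n + 1)) :
    ∃ M : ℤ, twistPhase θ (fun x => σ (x + 1)) =
      twistPhase θ σ - a * (∑ x, (((σ x).rev : ℕ) : ℝ)) + M * (2 * Real.pi) := by
  -- `q x = ⌊(val x + 1)/L⌋` and `r y = (rev σ_y : ℝ)`
  set q : ZMod L → ℕ := fun x => (x.val + 1) / L with hq
  set r : ZMod L → ℝ := fun y => (((σ y).rev : ℕ) : ℝ) with hr
  refine ⟨k * ((∑ x : ZMod L, q x * ((σ (x + 1)).rev : ℕ) : ℕ) : ℤ), ?_⟩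
  have h0 : twistPhase θ (fun x => σ (x + 1)) = ∑ x : ZMod L, θ x * r (x + 1) := rfl
  have h1 : twistPhase θ σ = ∑ x : ZMod L, θ (x + 1) * r (x + 1) := by
    rw [twistPhase]
    exact (Equiv.sum_comp (Equiv.addRight (1 : ZMod L)) (fun y => θ y * r y)).symm
  have h2 : (∑ x : ZMod L, (((σ x).rev : ℕ) : ℝ)) = ∑ x : ZMod L, r (x + 1) :=
    (Equiv.sum_comp (Equiv.addRight (1 : ZMod L)) (fun y => r y)).symm
  have h3 : ∀ x : ZMod L, θ (x + 1) = θ x + a - a * L * (q x : ℝ) := by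
    intro x
    rw [hθ, hθ, ZMod.val_add_one_real hL x]
    ring
  have h4 : (∑ x : ZMod L, θ (x + 1) * r (x + 1)) =
      (∑ x : ZMod L, θ x * r (x + 1)) + a * (∑ x : ZMod L, r (x + 1)) -
        a * L * ∑ x : ZMod L, (q x : ℝ) * r (x + 1) := by
    rw [Finset.mul_sum, Finset.mul_sum, ← Finset.sum_add_distrib, ← Finset.sum_sub_distrib]
    refine Finset.sum_congr rfl fun x _ => ?_
    rw [h3 x]
    ring
  have h5 : (((k * ((∑ x : ZMod L, q x * ((σ (x + 1)).rev : ℕ) : ℕ) : ℤ) : ℤ)) : ℝ) =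
      k * ∑ x : ZMod L, (q x : ℝ) * r (x + 1) := by
    push_cast
    rfl
  rw [h0, h1, h2, h4, h5]
  linear_combination (∑ x : ZMod L, (q x : ℝ) * r (x + 1)) * ha

/-- Entries of the twist after a translation: `U(σ(·+1)) = U(σ) · e^{i a N(σ)}` (the multiple of
`2π` acts trivially). Tasaki (2022) §3.2, proof of Lemma 3.3. [folklore] -/
theorem twistOp_apply_shift (hL : 2 ≤ L) {θ : ZMod L → ℝ} {a : ℝ} {k : ℤ}
    (hθ : ∀ x, θ x = a * (x.val : ℝ)) (ha : a * L = 2 * Real.pi * k)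
    (σ : TensorIndex (ZMod L) (n + 1)) :
    (twistOp θ : Op (ZMod L) (n + 1)) (fun x => σ (x + 1)) (fun x => σ (x + 1)) =
      (twistOp θ : Op (ZMod L) (n + 1)) σ σ *
        Complex.exp (I * a * ((∑ x, (((σ x).rev : ℕ) : ℝ) : ℝ) : ℂ)) := by
  obtain ⟨M, hM⟩ := twistPhase_shift n hL hθ ha σ
  rw [twistOp_apply, twistOp_apply, if_pos rfl, if_pos rfl, hM, ← Complex.exp_add]
  have : -(I * ((twistPhase θ σ - a * ∑ x, (((σ x).rev : ℕ) : ℝ) + M * (2 * Real.pi) : ℝ) : ℂ)) =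
      -(I * (twistPhase θ σ : ℂ)) + I * a * ((∑ x, (((σ x).rev : ℕ) : ℝ) : ℝ) : ℂ) +
        ((-M : ℤ) : ℂ) * (2 * Real.pi * I) := by
    push_cast
    ring
  rw [this, Complex.exp_add, Complex.exp_int_mul_two_pi_mul_I, mul_one]

/-- **Orthogonality of the twisted ground state (Lieb–Schultz–Mattis / Affleck–Lieb).** For the
half-odd-integer spin ring (`n` odd) with a unique ground state `ψ`, and a twist
`U = exp[-i Σ_x θ_x(Ŝᶻ_x + S)]` with `θ_x = a·val(x)`, `aL = 2πk`, `k` odd (the LSM twist `a = 2π/L`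
and its inverse `a = -2π/L`), `⟨ψ, Uψ⟩ = 0`: by translation covariance `ψ(σ(·+1)) = μψ(σ)`,
`|μ| = 1`, one has `⟨ψ,Uψ⟩ = Σ_σ U(σ)|ψ(σ)|² = Σ_σ U(σ(·+1))|ψ(σ)|² = Σ_σ e^{iaN(σ)}U(σ)|ψ(σ)|²`, and
on the support of `ψ` (the sector `Ŝᶻ_tot = 0`) `N(σ) = Ln/2`, `e^{iaLn/2} = e^{iπkn} = -1`.
Lieb–Schultz–Mattis, Ann. Phys. 16 (1961) 407, App. B; Affleck–Lieb (1986) Thm 1 (proof);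
Tasaki (2022) §1. [cite: AffleckLiebLMP1986, Thm. 1] -/
theorem lsm_twist_expect_eq_zero (hL : 2 ≤ L) (hn : Odd n)
    (hU : (heisenbergRing L n).HasUniqueGroundState)
    {ψ : TensorIndex (ZMod L) (n + 1) → ℂ} (hψ : ψ ∈ (heisenbergRing L n).groundSpace)
    {θ : ZMod L → ℝ} {a : ℝ} {k : ℤ} (hθ : ∀ x, θ x = a * (x.val : ℝ)) (hk : Odd k)
    (ha : a * L = 2 * Real.pi * k) :
    star ψ ⬝ᵥ (twistOp θ : Op (ZMod L) (n + 1)) *ᵥ ψ = 0 := by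
  by_cases hψ0 : ψ = 0
  · rw [hψ0, mulVec_zero, dotProduct_zero]
  obtain ⟨μ, hμ, hshift⟩ := groundState_shift_eq_smul n hU hψ hψ0
  have hsupp := (LiebMattis.mem_spinZSector_iff (Λ := ZMod L) n 0 ψ).1
    (groundState_mem_spinZSector_zero n hU hψ)
  -- the configuration shift as a bijection
  let g : TensorIndex (ZMod L) (n + 1) ≃ TensorIndex (ZMod L) (n + 1) :=
    { toFun := fun σ x => σ (x + 1)
      invFun := fun σ x => σ (x - 1)
      left_inv := fun σ => funext fun x => by simp [sub_add_cancel]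
      right_inv := fun σ => funext fun x => by simp [add_sub_cancel_right] }
  have hg : ∀ σ, g σ = fun x => σ (x + 1) := fun σ => rfl
  -- `⟨ψ, Uψ⟩ = Σ_σ U(σ) |ψ(σ)|²`
  have hX : star ψ ⬝ᵥ (twistOp θ : Op (ZMod L) (n + 1)) *ᵥ ψ =
      ∑ σ, (twistOp θ : Op (ZMod L) (n + 1)) σ σ * (star (ψ σ) * ψ σ) := by
    unfold dotProduct
    refine Finset.sum_congr rfl fun σ _ => ?_
    rw [Pi.star_apply, twistOp, mulVec_diagonal, diagonal_apply_eq]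
    ring
  -- `|ψ|²` is shift invariant
  have hwshift : ∀ σ, star (ψ (g σ)) * ψ (g σ) = star (ψ σ) * ψ σ := by
    intro σ
    have h := congrFun hshift σ
    simp only [Pi.smul_apply, smul_eq_mul] at h
    rw [hg]
    change star (ψ (fun x => σ (x + 1))) * ψ (fun x => σ (x + 1)) = _
    rw [h, star_mul', mul_mul_mul_comm, hμ, one_mul]
  -- on the support of `ψ`, `N(σ) = Ln/2`
  have hphase : ∀ σ, ψ σ ≠ 0 →
      Complex.exp (I * a * ((∑ x, (((σ x).rev : ℕ) : ℝ) : ℝ) : ℂ)) =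
        Complex.exp (I * a * (((L : ℝ) * n / 2 : ℝ) : ℂ)) := by
    intro σ hψσ
    have hs := hsupp σ hψσ
    rw [Complex.ofReal_zero] at hs
    have hN : ((∑ x, (((σ x).rev : ℕ) : ℝ) : ℝ) : ℂ) = (((L : ℝ) * n / 2 : ℝ) : ℂ) := by
      have h1 : ((∑ x, (((σ x).rev : ℕ) : ℝ) : ℝ) : ℂ) =
          ∑ x : ZMod L, ((n : ℂ) - ((σ x : ℕ) : ℂ)) := by
        push_cast
        refine Finset.sum_congr rfl fun x _ => ?_
        exact_mod_cast natCast_val_rev n (σ x)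
      have h2 : (∑ x : ZMod L, ((n : ℂ) - ((σ x : ℕ) : ℂ))) =
          (∑ x : ZMod L, ((n : ℂ) / 2 - ((σ x : ℕ) : ℂ))) + ∑ _x : ZMod L, (n : ℂ) / 2 := by
        rw [← Finset.sum_add_distrib]
        refine Finset.sum_congr rfl fun x _ => ?_
        ring
      rw [h1, h2, hs, Finset.sum_const, Finset.card_univ, ZMod.card, nsmul_eq_mul]
      push_cast
      ring
    rw [hN]
  -- `e^{iaLn/2} = e^{iπkn} = -1`
  have hm1 : Complex.exp (I * a * (((L : ℝ) * n / 2 : ℝ) : ℂ)) = -1 := by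
    have hkn : Odd (k * n) := hk.mul (by exact_mod_cast hn)
    have haL : (a : ℂ) * (L : ℂ) = 2 * Real.pi * k := by exact_mod_cast ha
    have : I * a * (((L : ℝ) * n / 2 : ℝ) : ℂ) = ((k * n : ℤ) : ℂ) * (Real.pi * I) := by
      push_cast
      linear_combination (I * (n : ℂ) / 2) * haL
    rw [this, Complex.exp_int_mul, Complex.exp_pi_mul_I, hkn.neg_one_zpow]
  -- reindex the sum by the shift and compare
  have hsum : (∑ σ, (twistOp θ : Op (ZMod L) (n + 1)) σ σ * (star (ψ σ) * ψ σ)) =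
      -(∑ σ, (twistOp θ : Op (ZMod L) (n + 1)) σ σ * (star (ψ σ) * ψ σ)) := by
    calc (∑ σ, (twistOp θ : Op (ZMod L) (n + 1)) σ σ * (star (ψ σ) * ψ σ))
        = ∑ σ, (twistOp θ : Op (ZMod L) (n + 1)) (g σ) (g σ) * (star (ψ (g σ)) * ψ (g σ)) :=
          (Equiv.sum_comp g (fun σ => (twistOp θ : Op (ZMod L) (n + 1)) σ σ *
            (star (ψ σ) * ψ σ))).symm
      _ = ∑ σ, -((twistOp θ : Op (ZMod L) (n + 1)) σ σ * (star (ψ σ) * ψ σ)) := by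
          refine Finset.sum_congr rfl fun σ _ => ?_
          rw [hwshift]
          by_cases hψσ : ψ σ = 0
          · rw [hψσ, mul_zero, mul_zero, mul_zero, neg_zero]
          · rw [hg, twistOp_apply_shift n hL hθ ha σ, hphase σ hψσ, hm1]
            ring
      _ = -(∑ σ, (twistOp θ : Op (ZMod L) (n + 1)) σ σ * (star (ψ σ) * ψ σ)) :=
          Finset.sum_neg_distrib _
  rw [hX]
  linear_combination (1 / 2 : ℂ) * hsum

end Ortho

section Assembly

variable {m : Type*} [Fintype m]

/-- Rayleigh quotient of a transformed vector: `⟨Uψ, M Uψ⟩ = ⟨ψ, (UᴴMU) ψ⟩`. [folklore] -/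
theorem star_mulVec_dotProduct_mulVec_mulVec (U M : Matrix m m ℂ) (ψ : m → ℂ) :
    star (U *ᵥ ψ) ⬝ᵥ M *ᵥ (U *ᵥ ψ) = star ψ ⬝ᵥ (Uᴴ * M * U) *ᵥ ψ := by
  simp only [star_mulVec, dotProduct_mulVec, vecMul_vecMul, Matrix.mul_assoc]

/-- Norm of a transformed vector: `⟨Uψ, Uψ⟩ = ⟨ψ, (UᴴU) ψ⟩`. [folklore] -/
theorem star_mulVec_dotProduct_mulVec (U : Matrix m m ℂ) (ψ : m → ℂ) :
    star (U *ᵥ ψ) ⬝ᵥ (U *ᵥ ψ) = star ψ ⬝ᵥ (Uᴴ * U) *ᵥ ψ := by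
  simp only [star_mulVec, dotProduct_mulVec, vecMul_vecMul]

end Assembly

end LiebSchultzMattis

open LiebSchultzMattis in
/-- **Discharge of `lsm_affleck_lieb` (hubbard.S14): the Lieb–Schultz–Mattis / Affleck–Lieb
theorem on the finite ring.** For odd `n` (spin `S = n/2` half-odd-integer) and every `L ≥ 2` for
which the antiferromagnetic Heisenberg ring `H = Σ_{i∈ℤ/L} 𝐒_i·𝐒_{i+1}` has a unique ground state
`ψ`, the gap satisfies `E₁ - E₀ ≤ π²n²/L = 4π²S²/L`. Proof (Lieb–Schultz–Mattis 1961, App. B;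
Affleck–Lieb 1986, Thm 1; Tasaki 2022, §1 and Lemma 3.1): with the twist
`U = exp[-i Σ_x (2π val(x)/L)(Ŝᶻ_x + S)]`, the trial states `Uψ` and `Uᴴψ` are orthogonal to `ψ`
(`lsm_twist_expect_eq_zero`: translation covariance of the unique ground state, `Ŝᶻ_tot ψ = 0`, and
`e^{iπn} = -1`) and `⟨Uψ,HUψ⟩ + ⟨Uᴴψ,HUᴴψ⟩ ≤ 2E₀ + 2π²n²/L` (`lsm_twist_energy_le`); the min–max
principle (`spectralGap_le_of_orthogonal`) applied to the better of the two bounds the gap. The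
constant is `C = π² n²`; the hypothesis `Even L` is not needed by the argument (for odd `L` the
uniqueness hypothesis is never satisfied). [cite: AffleckLiebLMP1986, Thm. 1] -/
theorem lsm_affleck_lieb_holds : lsm_affleck_lieb := by
  intro n hn
  refine ⟨Real.pi ^ 2 * (n : ℝ) ^ 2, ?_⟩
  intro L _ _ hL hU
  set H : Op (ZMod L) (n + 1) := heisenbergRing L n with hH
  have hHerm : H.IsHermitian := heisenbergRing_isHermitian L n
  have hL0 : (0 : ℝ) < L := by exact_mod_cast (show 0 < L by omega)
  -- a normalised ground-state vector
  haveI : Nonempty (TensorIndex (ZMod L) (n + 1)) := ⟨fun _ => 0⟩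
  obtain ⟨ψ, hψmem, hψ1⟩ : ∃ ψ : TensorIndex (ZMod L) (n + 1) → ℂ,
      ψ ∈ H.groundSpace ∧ star ψ ⬝ᵥ ψ = 1 := by
    obtain ⟨v, hv, hv0⟩ := (Submodule.ne_bot_iff _).1 (groundSpace_ne_bot_holds hHerm)
    set r : ℝ := ‖(WithLp.toLp 2 v : EuclideanSpace ℂ (TensorIndex (ZMod L) (n + 1)))‖ with hr
    have hr0 : 0 < r := norm_pos_iff.mpr fun h => hv0 ((toLp_two_eq_zero_iff v).1 h)
    refine ⟨((r : ℂ))⁻¹ • v, H.groundSpace.smul_mem _ hv, ?_⟩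
    rw [star_smul, smul_dotProduct, dotProduct_smul, star_dotProduct_self_eq_normSq_toLp, ← hr,
      smul_smul, smul_eq_mul]
    have hrc : (r : ℂ) ≠ 0 := by exact_mod_cast hr0.ne'
    simp only [Complex.star_def, map_inv₀, Complex.conj_ofReal]
    push_cast
    field_simp
  have hψ0 : ψ ≠ 0 := by
    rintro rfl
    rw [star_zero, zero_dotProduct] at hψ1
    exact zero_ne_one hψ1
  have hHψ : H *ᵥ ψ = (H.groundEnergy : ℂ) • ψ := (mem_groundSpace_iff H ψ).1 hψmem
  -- the twist and its inverse
  set θ : ZMod L → ℝ := fun x => 2 * Real.pi * (x.val : ℝ) / L with hθdef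
  set U : Op (ZMod L) (n + 1) := twistOp θ with hUdef
  have hθ : ∀ x, θ x = (2 * Real.pi / L) * (x.val : ℝ) := fun x => by rw [hθdef]; ring
  have hθ' : ∀ x, (-θ) x = (-(2 * Real.pi / L)) * (x.val : ℝ) := fun x => by
    rw [Pi.neg_apply, hθ]; ring
  have ha : (2 * Real.pi / L) * L = 2 * Real.pi * ((1 : ℤ) : ℝ) := by
    field_simp; push_cast; ring
  have ha' : (-(2 * Real.pi / L)) * L = 2 * Real.pi * ((-1 : ℤ) : ℝ) := by
    field_simp; push_cast; ring
  have horth₁ : star ψ ⬝ᵥ U *ᵥ ψ = 0 :=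
    lsm_twist_expect_eq_zero n hL hn hU hψmem hθ odd_one ha
  have horth₂ : star ψ ⬝ᵥ Uᴴ *ᵥ ψ = 0 := by
    rw [hUdef, twistOp_conjTranspose]
    exact lsm_twist_expect_eq_zero n hL hn hU hψmem hθ' (by decide) ha'
  -- the two trial states
  have hU1 : Uᴴ * U = 1 := twistOp_conjTranspose_mul_self θ
  have hU2 : U * Uᴴ = 1 := twistOp_mul_conjTranspose_self θ
  have hφ₁1 : star (U *ᵥ ψ) ⬝ᵥ (U *ᵥ ψ) = 1 := by
    rw [star_mulVec_dotProduct_mulVec, hU1, one_mulVec, hψ1]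
  have hφ₂1 : star (Uᴴ *ᵥ ψ) ⬝ᵥ (Uᴴ *ᵥ ψ) = 1 := by
    rw [star_mulVec_dotProduct_mulVec, conjTranspose_conjTranspose, hU2, one_mulVec, hψ1]
  have hne : ∀ φ : TensorIndex (ZMod L) (n + 1) → ℂ, star φ ⬝ᵥ φ = 1 → φ ≠ 0 := by
    rintro φ hφ rfl
    rw [star_zero, zero_dotProduct] at hφ
    exact zero_ne_one hφ
  have hR₁ : star (U *ᵥ ψ) ⬝ᵥ H *ᵥ (U *ᵥ ψ) = star ψ ⬝ᵥ (Uᴴ * H * U) *ᵥ ψ :=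
    star_mulVec_dotProduct_mulVec_mulVec U H ψ
  have hR₂ : star (Uᴴ *ᵥ ψ) ⬝ᵥ H *ᵥ (Uᴴ *ᵥ ψ) = star ψ ⬝ᵥ (U * H * Uᴴ) *ᵥ ψ := by
    rw [star_mulVec_dotProduct_mulVec_mulVec, conjTranspose_conjTranspose]
  -- the energy estimate
  have hE := lsm_twist_energy_le n hL hHψ hψ1
  rw [← hθdef, ← hUdef, ← hH] at hE
  -- conclude with the better trial state
  have hgoal : ∀ φ : TensorIndex (ZMod L) (n + 1) → ℂ, star φ ⬝ᵥ φ = 1 → star ψ ⬝ᵥ φ = 0 →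
      (star φ ⬝ᵥ H *ᵥ φ).re ≤ H.groundEnergy + Real.pi ^ 2 * (n : ℝ) ^ 2 / L →
      H.spectralGap ≤ Real.pi ^ 2 * (n : ℝ) ^ 2 / L := by
    intro φ hφ1 hφorth hφE
    have h := spectralGap_le_of_orthogonal hHerm hU hHψ hψ0 (hne φ hφ1) hφorth
      (e := H.groundEnergy + Real.pi ^ 2 * (n : ℝ) ^ 2 / L)
      (by rw [hφ1, Complex.one_re, mul_one]; exact hφE)
    linarith
  rcases le_total (star ψ ⬝ᵥ (Uᴴ * H * U) *ᵥ ψ).re (star ψ ⬝ᵥ (U * H * Uᴴ) *ᵥ ψ).re with h | h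
  · refine hgoal (U *ᵥ ψ) hφ₁1 horth₁ ?_
    rw [hR₁]
    have : (star ψ ⬝ᵥ (Uᴴ * H * U) *ᵥ ψ).re ≤ H.groundEnergy + Real.pi ^ 2 * (n : ℝ) ^ 2 / L := by
      have h2 : 2 * (star ψ ⬝ᵥ (Uᴴ * H * U) *ᵥ ψ).re ≤
          2 * H.groundEnergy + 2 * Real.pi ^ 2 * (n : ℝ) ^ 2 / L := by linarith
      have h3 : 2 * Real.pi ^ 2 * (n : ℝ) ^ 2 / L = 2 * (Real.pi ^ 2 * (n : ℝ) ^ 2 / L) := by ring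
      linarith
    exact this
  · refine hgoal (Uᴴ *ᵥ ψ) hφ₂1 horth₂ ?_
    rw [hR₂]
    have h3 : 2 * Real.pi ^ 2 * (n : ℝ) ^ 2 / L = 2 * (Real.pi ^ 2 * (n : ℝ) ^ 2 / L) := by ring
    linarith

end Literature.MathematicalPhysics.QuantumLattice
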